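import Summits.KontsevichZagierPeriods.KontsevichZagierPeriods.Theorems.LinRedNormalFormArrangementNormalFormSeparateThreeHIRimDirs
import Summits.KontsevichZagierPeriods.KontsevichZagierPeriods.Theorems.LinRedNormalFormArrangementNormalFormSeparateThreeHILower

/-!
# The column bound at a rim vertex on the pole plane

(Line `janus-bands`, crux `ArrangementNormalForm`, stub `stub_separateThreeZero`, part `HIRim` of
the termwise numerator split `separateThree_hI` under the rim condition.)

`rim_column` (registered as `separateThree_rim`): at a point `(v₀, 0)` of the closed cell on the
pole plane whose closed vertical fibre is `{0}`, with the cell above the pole plane, the integrand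
absolutely integrable, no active letter identically zero and the RIM CONDITION, the fibre
integrals of every absolute Taylor piece over base points `v₀ + u`, `0 < ‖u‖ < δ`, are bounded by
`C · (FF(v₀ + u) + ‖u‖⁻¹ + 1)`. Proof: every unit direction has a neighbourhood of directions with
such a bound (`dir_bound`: empty / thick / moderate / rim / contact directions, parts
`HIDirections`, `HIContact`, `HIRimDirs`, the exponent inequality of part `HILower` feeding the rim
directions), and the unit circle is compact.
-/

noncomputable section

open Set MeasureTheory Filter Topology
open scoped ENNReal

namespace Summit.KontsevichZagierPeriods.ArrangementNormalForm.JanusBands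

namespace SepThree

section Rim

variable {J m : ℕ} (g : Fin J → Con) (κ : Fin m → Fin 2 → ℝ) (μ : Fin m → ℝ) (e : Fin m → ℕ)
  (N : ℕ) (q : ℕ → MvPolynomial (Fin 2) ℝ) (n : ℕ) (v₀ : Fin 2 → ℝ)

/-- Pieces with vanishing Taylor data have vanishing fibre integrals. -/
theorem FI_eq_zero_of_coef_zero {d : ℕ} (hNd : N ≤ d + 1) {c : Coef d}
    (hc : ∀ (i : ℕ) (hi : i < N) (u : Fin 2 → ℝ),
      MvPolynomial.eval (v₀ + u) (q i) = SepTwo.pev₂ (c ⟨i, lt_of_lt_of_le hi hNd⟩) (u 0) (u 1))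
    (h0 : c = 0) (Ω : Set ((Fin 2 → ℝ) × ℝ)) (i : ℕ) (hi : i < N) (u : Fin 2 → ℝ) :
    FI κ μ e q n Ω i (v₀ + u) = 0 := by
  unfold FI
  have hQ : Qv q i (v₀ + u) = 0 := by
    simp only [Qv, hc i hi u, h0]
    simp [SepTwo.pev₂]
  have : ∀ w, ‖tpiece κ μ e q n i (v₀ + u, w)‖ₑ = 0 := fun w => by
    simp [tpiece, hQ]
  simp only [this, lintegral_zero]

/-- **Directional bound.** Under the hypotheses of `rim_column`, every unit direction `d` has a
neighbourhood of directions over which `FI i (v₀ + u) ≤ C (FF(v₀ + u) + ‖u‖⁻¹ + 1)`. -/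
theorem dir_bound (hB : (bots g v₀).Nonempty) (hT : (tops g v₀).Nonempty)
    (hcl : ((v₀, 0) : (Fin 2 → ℝ) × ℝ) ∈ closure (Om3 g))
    (hup : ∀ p ∈ closure (Om3 g), 0 ≤ p.2)
    {δ₁ : ℝ} (hδ₁ : 0 < δ₁) (hfib : ∀ u : Fin 2 → ℝ, ‖u‖ < δ₁ → fib (Om3 g) (v₀ + u) = Kfib g v₀ u)
    (hR : ∀ p ∈ closure (Om3 g), (∃ j, e j ≠ 0 ∧ lval κ μ j p.1 = 0) →
      (n ≠ 0 ∧ p.2 = 0) ∨ ∃ p' ∈ closure (Om3 g), p' ≠ p ∧ p'.1 = p.1)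
    {d : ℕ} (hNd : N ≤ d + 1) (c : Coef d)
    (hc : ∀ (i : ℕ) (hi : i < N) (u : Fin 2 → ℝ),
      MvPolynomial.eval (v₀ + u) (q i) = SepTwo.pev₂ (c ⟨i, lt_of_lt_of_le hi hNd⟩) (u 0) (u 1))
    (h : (nz c).Nonempty) (hexp : n + Eord κ μ e v₀ < ord c h + 3) (i : ℕ) (hi : i < N)
    (dd : Fin 2 → ℝ) (hdd : ‖dd‖ = 1) :
    ∃ ε > 0, ∃ δ > 0, ∃ C : ℝ≥0∞, C ≠ ∞ ∧ ∀ u : Fin 2 → ℝ, u ≠ 0 → ‖u‖ < δ → ‖udir u - dd‖ < ε →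
      FI κ μ e q n (Om3 g) i (v₀ + u) ≤
        C * (FF κ μ e N q n (Om3 g) (v₀ + u) + ENNReal.ofReal ‖u‖⁻¹ + 1) := by
  have hdd0 : dd ≠ 0 := fun h0 => by rw [h0, norm_zero] at hdd; exact zero_ne_one hdd
  have hweak : ∀ (C X : ℝ≥0∞) (u : Fin 2 → ℝ), X ≤ C * FF κ μ e N q n (Om3 g) (v₀ + u) →
      X ≤ C * (FF κ μ e N q n (Om3 g) (v₀ + u) + ENNReal.ofReal ‖u‖⁻¹ + 1) := fun C X u hX =>
    hX.trans (by gcongr; rw [add_assoc]; exact le_self_add)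
  -- empty directions
  by_cases hemp : (∃ j ∈ act g v₀, (g j).2.1 = 0 ∧ blin (g j) dd < 0) ∨ hhi g v₀ hT dd < hlo g v₀ hB dd
  · obtain ⟨ε, hε, hKe⟩ := dir_empty g v₀ hB hT hemp
    refine ⟨ε, hε, δ₁, hδ₁, 0, ENNReal.zero_ne_top, fun u hu huδ hud => ?_⟩
    rw [FI_eq_zero_of_empty κ μ e q n i (by rw [hfib u huδ, hKe u hu hud])]
    exact zero_le
  push Not at hemp
  obtain ⟨hv, hle⟩ := hemp
  rcases dir_cases g v₀ hB hT hcl hup dd with habs | ⟨h1, h2⟩ | ⟨h1, h2⟩ | ⟨h1, h2⟩ | ⟨h1, h2⟩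
  · exfalso
    rcases habs with ⟨j, hj, hc0, hneg⟩ | hlt
    · exact absurd (hv j hj hc0) (not_le.2 hneg)
    · exact absurd hle (not_le.2 hlt)
  · -- thick directions
    obtain ⟨ε, hε, hth⟩ := dir_thick g v₀ hB hT hcl hup h1 h2
    obtain ⟨C, hC, hbd⟩ := bound_of_thick g κ μ e N q n v₀ hB hT one_half_pos one_half_lt_one i hi
    refine ⟨ε, hε, δ₁, hδ₁, C, hC, fun u hu huδ hud => hweak C _ u ?_⟩
    exact hbd u (hfib u huδ) (hth u hu hud)
  · -- moderate directions
    obtain ⟨ε, hε, a₀, b₀, A₁, B₁, hA, hA1, hab, hbB, hmo⟩ := dir_moderate g v₀ hB hT h1 h2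
    obtain ⟨C, hC, hbd⟩ := bound_of_moderate g κ μ e N q n v₀ hA hA1 hab hbB i hi
    refine ⟨ε, hε, δ₁, hδ₁, C, hC, fun u hu huδ hud => hweak C _ u ?_⟩
    exact hbd u hu (hfib u huδ) (hmo u hu hud)
  · -- rim directions
    obtain ⟨ε₁, hε₁, A₁, B₁, hA, hAB, hri⟩ := dir_rim g v₀ hB hT h1 h2
    have htr := rim_letters g κ μ e n v₀ hB hT hcl hR h1 h2 hv
    obtain ⟨ε₂, hε₂, δ₂, hδ₂, cW, hcW, hWl⟩ := Wt_lower_dir κ μ e v₀ htr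
    obtain ⟨δ₃, hδ₃, C, hC, hbd⟩ := bound_of_rim g κ μ e N q n v₀ hA hAB hcW hNd c hc h hexp i hi
    refine ⟨min ε₁ ε₂, lt_min hε₁ hε₂, min δ₁ (min δ₂ δ₃), lt_min hδ₁ (lt_min hδ₂ hδ₃), C, hC,
      fun u hu huδ hud => ?_⟩
    have hb := hbd u hu (huδ.trans_le ((min_le_right _ _).trans (min_le_right _ _)))
      (hfib u (huδ.trans_le (min_le_left _ _))) (hri u hu (hud.trans_le (min_le_left _ _)))
      (hWl u hu (huδ.trans_le ((min_le_right _ _).trans (min_le_left _ _)))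
        (hud.trans_le (min_le_right _ _)))
    refine hb.trans ?_
    gcongr
    calc ENNReal.ofReal ‖u‖⁻¹ ≤ FF κ μ e N q n (Om3 g) (v₀ + u) + ENNReal.ofReal ‖u‖⁻¹ := le_add_self
      _ ≤ _ := le_self_add
  · -- contact directions
    obtain ⟨ε, hε, θ, hθ0, hθ1, hco⟩ := dir_contact g v₀ hB hT hcl hup hdd0 h1 h2
    obtain ⟨C, hC, hbd⟩ := bound_of_thick g κ μ e N q n v₀ hB hT hθ0 hθ1 i hi
    refine ⟨ε, hε, δ₁, hδ₁, C, hC, fun u hu huδ hud => hweak C _ u ?_⟩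
    exact hbd u (hfib u huδ) (hco u hu hud)

/-- **The column bound at a rim vertex on the pole plane.** See the module docstring. -/
theorem rim_column (hbd : Bornology.IsBounded (Om3 g))
    (hcl : ((v₀, 0) : (Fin 2 → ℝ) × ℝ) ∈ closure (Om3 g))
    (hZ : ∀ w : ℝ, ((v₀, w) : (Fin 2 → ℝ) × ℝ) ∈ closure (Om3 g) → w = 0)
    (hpos : ∀ p ∈ Om3 g, 0 < p.2) (hint : IntegrableOn (Fform κ μ e N q n) (Om3 g))
    (hnd : ∀ j, e j ≠ 0 → ¬(κ j = 0 ∧ μ j = 0))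
    (hR : ∀ p ∈ closure (Om3 g), (∃ j, e j ≠ 0 ∧ lval κ μ j p.1 = 0) →
      (n ≠ 0 ∧ p.2 = 0) ∨ ∃ p' ∈ closure (Om3 g), p' ≠ p ∧ p'.1 = p.1)
    (i : ℕ) (hi : i < N) :
    ∃ δ > 0, ∃ C : ℝ≥0∞, C ≠ ∞ ∧ ∀ u : Fin 2 → ℝ, u ≠ 0 → ‖u‖ < δ →
      FI κ μ e q n (Om3 g) i (v₀ + u) ≤
        C * (FF κ μ e N q n (Om3 g) (v₀ + u) + ENNReal.ofReal ‖u‖⁻¹ + 1) := by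
  classical
  have hup : ∀ p ∈ closure (Om3 g), 0 ≤ p.2 :=
    fun p hp => closure_minimal (fun q (hq : q ∈ Om3 g) => (hpos q hq).le)
      (isClosed_le continuous_const continuous_snd) hp
  obtain ⟨jb, hjb, hjbc⟩ := exists_active_bot g v₀ hcl hZ
  obtain ⟨jt, hjt, hjtc⟩ := exists_active_top g v₀ hcl hZ
  have hB : (bots g v₀).Nonempty := ⟨jb, (mem_bots g v₀).2 ⟨hjb, hjbc⟩⟩
  have hT : (tops g v₀).Nonempty := ⟨jt, (mem_tops g v₀).2 ⟨hjt, hjtc⟩⟩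
  obtain ⟨δ₁, hδ₁, hfib⟩ := fib_eq_Kfib g v₀ hB hT hbd hcl hZ
  -- Taylor data at `v₀`
  obtain ⟨d, hNd, c, hc, hc0⟩ := exists_coef_data N q v₀
  by_cases hnz : ¬(nz c).Nonempty
  · rw [Finset.not_nonempty_iff_eq_empty] at hnz
    have h0 := eq_zero_of_nz_eq_empty hnz
    refine ⟨1, one_pos, 0, ENNReal.zero_ne_top, fun u _ _ => ?_⟩
    rw [FI_eq_zero_of_coef_zero κ μ e N q n v₀ hNd hc h0 (Om3 g) i hi u]
    exact zero_le
  push Not at hnz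
  -- the exponent inequality
  have hnd' : ∀ j, lval κ μ j v₀ = 0 → e j ≠ 0 → κ j ≠ 0 := by
    intro j hjv hej hκ
    refine hnd j hej ⟨hκ, ?_⟩
    simpa [lval, hκ] using hjv
  have hexp := exponent_lt3 g κ μ e N q n v₀ hcl hpos hint hnd' hNd c hc hc0 hnz
  -- directional bounds and compactness of the unit circle
  have hP := dir_bound g κ μ e N q n v₀ hB hT hcl hup hδ₁ hfib hR hNd c hc hnz hexp i hi
  set S : Set (Fin 2 → ℝ) := Metric.sphere 0 1 with hS
  have hSc : IsCompact S := isCompact_sphere 0 1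
  have hmemS : ∀ dd ∈ S, ‖dd‖ = 1 := fun dd hdd => by simpa [hS] using hdd
  choose ε hε δ hδ C hC hbound using fun dd : S => hP dd.1 (hmemS dd.1 dd.2)
  obtain ⟨t, ht⟩ := hSc.elim_finite_subcover (fun dd : S => Metric.ball dd.1 (ε dd))
    (fun _ => Metric.isOpen_ball) (fun dd hdd => mem_iUnion.2 ⟨⟨dd, hdd⟩, Metric.mem_ball_self (hε _)⟩)
  -- the circle is non-empty, so the subcover is
  have hd₀ : (fun _ : Fin 2 => (1 : ℝ)) ∈ S := by
    rw [hS, mem_sphere_zero_iff_norm, pi_norm_const, norm_one]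
  have htne : t.Nonempty := by
    obtain ⟨dd, hdd⟩ := mem_iUnion.1 (ht hd₀)
    obtain ⟨hddt, -⟩ := mem_iUnion.1 hdd
    exact ⟨dd, hddt⟩
  refine ⟨t.inf' htne δ, (Finset.lt_inf'_iff _).2 fun dd _ => hδ dd, ∑ dd ∈ t, C dd,
    ENNReal.sum_ne_top.2 fun dd _ => hC dd, fun u hu huδ => ?_⟩
  have hdirS : udir u ∈ S := by rw [hS, mem_sphere_zero_iff_norm]; exact norm_dir hu
  obtain ⟨dd, hdd⟩ := mem_iUnion.1 (ht hdirS)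
  obtain ⟨hddt, hball⟩ := mem_iUnion.1 hdd
  rw [Metric.mem_ball, dist_eq_norm] at hball
  have hb := hbound dd u hu (huδ.trans_le (Finset.inf'_le δ hddt)) hball
  refine hb.trans ?_
  gcongr
  exact Finset.single_le_sum (fun _ _ => zero_le) hddt

end Rim

end SepThree

/-- **The column bound at a rim vertex on the pole plane** (registered part of
`stub_separateThreeZero`; literal form of `SepThree.rim_column`): at a point `(v₀, 0)` of the
closure of the bounded open polyhedral cell `Ω` whose closed vertical fibre is `{0}`, with `Ω` above
the pole plane, the integrand `Fform` absolutely integrable on `Ω`, no letter of non-zero exponent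
identically zero, and the rim condition, the fibre integral of the `i`-th absolute Taylor piece over
the base points `v₀ + u`, `0 < ‖u‖ < δ`, is at most `C · (FF(v₀ + u) + ‖u‖⁻¹ + 1)`. -/
theorem separateThree_rim {J m : ℕ} (g : Fin J → (Fin 2 → ℝ) × ℝ × ℝ) (κ : Fin m → Fin 2 → ℝ) (μ : Fin m → ℝ) (e : Fin m → ℕ) (N : ℕ) (q : ℕ → MvPolynomial (Fin 2) ℝ) (n : ℕ) (v₀ : Fin 2 → ℝ) (hbd : Bornology.IsBounded (SepThree.Om3 g)) (hcl : ((v₀, 0) : (Fin 2 → ℝ) × ℝ) ∈ closure (SepThree.Om3 g)) (hZ : ∀ w : ℝ, ((v₀, w) : (Fin 2 → ℝ) × ℝ) ∈ closure (SepThree.Om3 g) → w = 0) (hpos : ∀ p ∈ SepThree.Om3 g, 0 < p.2) (hint : MeasureTheory.IntegrableOn (SepThree.Fform κ μ e N q n) (SepThree.Om3 g)) (hnd : ∀ j, e j ≠ 0 → ¬(κ j = 0 ∧ μ j = 0)) (hR : ∀ p ∈ closure (SepThree.Om3 g), (∃ j, e j ≠ 0 ∧ SepThree.lval κ μ j p.1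 = 0) → (n ≠ 0 ∧ p.2 = 0) ∨ ∃ p' ∈ closure (SepThree.Om3 g), p' ≠ p ∧ p'.1 = p.1) (i : ℕ) (hi : i < N) : ∃ δ > 0, ∃ C : ENNReal, C ≠ ⊤ ∧ ∀ u : Fin 2 → ℝ, u ≠ 0 → ‖u‖ < δ → SepThree.FI κ μ e q n (SepThree.Om3 g) i (v₀ + u) ≤ C * (SepThree.FF κ μ e N q n (SepThree.Om3 g) (v₀ + u) + ENNReal.ofReal ‖u‖⁻¹ + 1) := by
  exact SepThree.rim_column g κ μ e N q n v₀ hbd hcl hZ hpos hint hnd hR i hi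

end Summit.KontsevichZagierPeriods.ArrangementNormalForm.JanusBands
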